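import Mathlib
import Literature.Probability.LatticeModels.GKSInequalities
import Summits.CriticalPhenomena.Ising3DConformalLimit.Theses.PrecisionLaplacian
import Summits.CriticalPhenomena.Ising3DConformalLimit.Theorems.PrecisionLaplacianInverseMFerromagnetEntryNonposOfPcov
import Summits.CriticalPhenomena.Ising3DConformalLimit.Theorems.PrecisionLaplacianInverseMFerromagnetCondExpEqFrozen
import Summits.CriticalPhenomena.Ising3DConformalLimit.Theorems.PrecisionLaplacianInverseMFerromagnetCondCovNonneg
import Summits.CriticalPhenomena.Ising3DConformalLimit.Theorems.PrecisionLaplacianInverseMFerromagnetLevelTwo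
import Summits.CriticalPhenomena.Ising3DConformalLimit.Theorems.PrecisionLaplacianInverseMFerromagnetGhsPm
import Summits.CriticalPhenomena.Ising3DConformalLimit.Theorems.PrecisionLaplacianInverseMFerromagnetLevelThree
import Summits.CriticalPhenomena.Ising3DConformalLimit.Theorems.PrecisionLaplacianInverseMFerromagnetLevelLeOne
import Summits.CriticalPhenomena.Ising3DConformalLimit.Theorems.PrecisionLaplacianInverseMFerromagnetPcovOfIm
import Summits.CriticalPhenomena.Ising3DConformalLimit.Theorems.PrecisionLaplacianInverseMFerromagnetCofactorSignOfPosV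
import Summits.CriticalPhenomena.Ising3DConformalLimit.Theorems.PrecisionLaplacianInverseMFerromagnetImOfCofactorSign
import Summits.CriticalPhenomena.Ising3DConformalLimit.Theorems.PrecisionLaplacianInverseMFerromagnetRowDegLeTwo
import Summits.CriticalPhenomena.Ising3DConformalLimit.Theorems.PrecisionLaplacianInverseMFerromagnetImDeg3OfNonadj
import Summits.CriticalPhenomena.Ising3DConformalLimit.Theorems.PrecisionLaplacianInverseMFerromagnetImOfImDeg3
import Summits.CriticalPhenomena.Ising3DConformalLimit.Theorems.PrecisionLaplacianInverseMFerromagnetImNonadjOfLaw2Aux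
import Summits.CriticalPhenomena.Ising3DConformalLimit.Theorems.PrecisionLaplacianInverseMFerromagnetImNonadjOfLaw2Aux2
import Summits.CriticalPhenomena.Ising3DConformalLimit.Theorems.PrecisionLaplacianInverseMFerromagnetImLeFive
import Summits.CriticalPhenomena.Ising3DConformalLimit.Theorems.PrecisionLaplacianInverseMFerromagnetDbOfIm
import Summits.CriticalPhenomena.Ising3DConformalLimit.Theorems.PrecisionLaplacianInverseMFerromagnetCyclePrecision
import Summits.CriticalPhenomena.Ising3DConformalLimit.Theorems.PrecisionLaplacianInverseMFerromagnetOneSum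
import Summits.CriticalPhenomena.Ising3DConformalLimit.Theorems.PrecisionLaplacianInverseMFerromagnetTwoSepMarkov
import Summits.CriticalPhenomena.Ising3DConformalLimit.Theorems.PrecisionLaplacianInverseMFerromagnetTwoSumPrecision
import Summits.CriticalPhenomena.Ising3DConformalLimit.Theorems.PrecisionLaplacianInverseMFerromagnetGlueIneq
import Summits.CriticalPhenomena.Ising3DConformalLimit.Theorems.PrecisionLaplacianInverseMFerromagnetDbDeg2Eq
import Summits.CriticalPhenomena.Ising3DConformalLimit.Theorems.PrecisionLaplacianInverseMFerromagnetMarginalTwoSep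
import Summits.CriticalPhenomena.Ising3DConformalLimit.Theorems.PrecisionLaplacianInverseMFerromagnetImNonadjOfLaw2
import Summits.CriticalPhenomena.Ising3DConformalLimit.Theorems.PrecisionLaplacianInverseMFerromagnetSeriesParallel
import Summits.CriticalPhenomena.Ising3DConformalLimit.Theorems.PrecisionLaplacianInverseMFerromagnetK23Precision
import Summits.CriticalPhenomena.Ising3DConformalLimit.Theorems.PrecisionLaplacianInverseMFerromagnetSubdivideEntryInvariant
import Summits.CriticalPhenomena.Ising3DConformalLimit.Theorems.PrecisionLaplacianInverseMFerromagnetPrecisionZeros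
import Summits.CriticalPhenomena.Ising3DConformalLimit.Theorems.PrecisionLaplacianInverseMFerromagnetTwinNonpos
import Summits.CriticalPhenomena.Ising3DConformalLimit.Theorems.PrecisionLaplacianInverseMFerromagnetDbLocal
import Summits.CriticalPhenomena.Ising3DConformalLimit.Theorems.PrecisionLaplacianInverseMFerromagnetSPClosure
import Summits.CriticalPhenomena.Ising3DConformalLimit.Theorems.PrecisionLaplacianInverseMFerromagnetOddGramDuality
import Summits.CriticalPhenomena.Ising3DConformalLimit.Theorems.PrecisionLaplacianInverseMFerromagnetAfPrecisionNonnegFour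
import Summits.CriticalPhenomena.Ising3DConformalLimit.Theorems.PrecisionLaplacianInverseMFerromagnetLaw2Four
import Summits.CriticalPhenomena.Ising3DConformalLimit.Theorems.PrecisionLaplacianInverseMFerromagnetNim3SixOf
import Summits.CriticalPhenomena.Ising3DConformalLimit.Theorems.PrecisionLaplacianInverseMFerromagnetWheelCore
import Summits.CriticalPhenomena.Ising3DConformalLimit.Theorems.PrecisionLaplacianInverseMFerromagnetWheelRingsum
import Summits.CriticalPhenomena.Ising3DConformalLimit.Theorems.PrecisionLaplacianInverseMFerromagnetWheelSl2
import Summits.CriticalPhenomena.Ising3DConformalLimit.Theorems.PrecisionLaplacianInverseMFerromagnetWheelColumn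
import Summits.CriticalPhenomena.Ising3DConformalLimit.Theorems.PrecisionLaplacianInverseMFerromagnetWheel
import Summits.CriticalPhenomena.Ising3DConformalLimit.Theorems.PrecisionLaplacianInverseMFerromagnetWheelNonneg
import Summits.CriticalPhenomena.Ising3DConformalLimit.Theorems.PrecisionLaplacianInverseMFerromagnetImOfSp
import Summits.CriticalPhenomena.Ising3DConformalLimit.Theorems.PrecisionLaplacianInverseMFerromagnetHubPair
import Summits.CriticalPhenomena.Ising3DConformalLimit.Theorems.PrecisionLaplacianInverseMFerromagnetPencilMixture
import Summits.CriticalPhenomena.Ising3DConformalLimit.Theorems.PrecisionLaplacianInverseMFerromagnetContractionConditioning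
import Summits.CriticalPhenomena.Ising3DConformalLimit.Theorems.PrecisionLaplacianInverseMFerromagnetRowTransferOfAmp
import Summits.CriticalPhenomena.Ising3DConformalLimit.Theorems.PrecisionLaplacianInverseMFerromagnetImOfRowTransfer
import Summits.CriticalPhenomena.Ising3DConformalLimit.Theorems.PrecisionLaplacianInverseMFerromagnetLaw2FourMtp2
import Summits.CriticalPhenomena.Ising3DConformalLimit.Theorems.PrecisionLaplacianInverseMFerromagnetMarginalFourMtp2
import Summits.CriticalPhenomena.Ising3DConformalLimit.Theorems.PrecisionLaplacianInverseMFerromagnetLaw2FourVisible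
import Summits.CriticalPhenomena.Ising3DConformalLimit.Theorems.PrecisionLaplacianInverseMFerromagnetLaw2FourVisibleAssembly
import Summits.CriticalPhenomena.Ising3DConformalLimit.Theorems.PrecisionLaplacianInverseMFerromagnetTwoClampSecondDiff
import Summits.CriticalPhenomena.Ising3DConformalLimit.Theorems.PrecisionLaplacianInverseMFerromagnetStrictlyUltrametric
import HarnessLib

/-!
# Crux `PrecisionLaplacian.InverseMFerromagnet` (stmt-CriticalPhenomena-4798) — line `Sketch`, skeleton v25
# (partial-covariance ladder; continuation lead c8, 2026-08-17; v25 = v24 with U1 `helper_strictlyUltrametric_inverse` LANDED p170719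
# and imported (5 sorries: 3 ≡ IM + rungs R1/R2); v24 = v23 with K2 LANDED p170265 and imported + U1 stub; v23 = v22 + K2
# `helper_twoClamp_secondDiff_nonpos` (pairwise cubic law); v22 = v21 + assembly p160125 imported + the level-4 RUNG
# stated as conjectural stubs R1 `stub_cpl4`, R2 `stub_level4`; v21 = v20 with G1–G3 LANDED (p159751, p159067, p159059) and imported,
# `helper_law2_fourVisible` sorry-free; v20 = v19 + the LEVEL-4 Gram stubs G1–G3
# `helper_law2_four_mtp2` / `helper_marginal_four_mtp2` / `helper_law2_fourVisible_of` and their assembly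
# `helper_law2_fourVisible` (Law₂ on four VISIBLE sites with hidden spins; FINDINGS-c8 L1–L2); lead c7: v19 = v18 with F2 `stub_rowTransfer_of_amp` (p153932) and F3 `stub_im_of_rowTransfer`
# (p153930) LANDED and imported — AMP ⇒ IM is a kernel theorem; the crux is kernel-equivalent to the ONE open stub `stub_amp`; v18 = v17 + CORE F, the ROW TRANSFER: stubs `stub_amp` (open core,
# c5's AmpU4 off the pair, ≡ IM), `stub_rowTransfer_of_amp` (block-inverse identity), `stub_im_of_rowTransfer` (induction on nonzero bonds),
# composition `InverseMFerromagnet_of := im_via_amp`; v17 = v16 + E4/E5 landed (p149870, p150340); v16 = v15 with E2 `stub_im_hubpair` (p148342) and E3 `stub_im_of_sp` (p148185)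
# LANDED and imported — the crux is now kernel-equivalent to the ONE open stub `stub_sp`; v15 = v14 + CORE E, the deletion–contraction pencil:
# stubs `stub_sp` (open core ≡ IM), `stub_im_hubpair` (series–parallel base), `stub_im_of_sp` (induction on nonzero
# couplings) and the composition `InverseMFerromagnet_of := im_via_sp`; lead c6: v14 = v13 + `helper_im_wheel_nonneg` imported; v13 = the WHEEL theorem imported (`helper_im_wheel` + its four
# stub modules, Theorem W: IM for all wheels, lead c6); v10 = v9 + the c5 landings imported:
# `helper_odd_gram_duality` p128610, `helper_af_precision_nonneg_four` p129018, **`helper_law2_four` p129163 =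
# the open core `stub_law2` ON FOUR SITES for all couplings**, `helper_nim3_six_of` p129538; stubs unchanged)

THE CRUX (IM).  For a finite zero-field pair ferromagnet (`gksExpect univ K C`, `K ≥ 0`, `|C i| = 2`)
with spin second-moment matrix `Σ_{pq} = ⟨σ_pσ_q⟩`, every off-diagonal entry of `Σ⁻¹` is `≤ 0`.

STATE OF THE LINE (v5c = v5b + the series–parallel programme D6–D8; v5b = v5 + the separator-gluing stubs D3–D5 and `helper_im_of_nim3`; v5: the landed modules are now IMPORTED instead of restated — the ladder S1–S6,
level ≤ 1, closure, core-A links, core-B links B1/B2, core-C links C3/C4/C5 and the C2 auxiliaries are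
kernel facts of the tree; only genuinely open statements carry `sorry`).
* LADDER (imported): S1 `stub_entry_nonpos_of_pcov` (p88352), S2 `stub_condExp_eq_frozen` (p89203),
  S3 `stub_condCov_nonneg` (p88377), S4 `stub_level_two` (p88454), S5 `stub_ghs_pm` (p88412),
  S6 `stub_level_three` (p88806+p89955), level ≤ 1 `pcov_nonneg_of_card_le_one` (p87030),
  closure `stub_pcov_of_im` (p91148) ⇒ `helper_im_le_five` (IM on ≤ 5 sites) is PROVED BELOW, sorry-free.
* CORE A (analytic; links p91515, p90559, p90981 landed): `stub_qpl2` OPEN (≡ IM by the c1 worker's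
  paper theorem; registered in v2/v3, not restated).
* CORE B (combinatorial): `stub_posV` OPEN (coefficientwise, strictly stronger than IM); bridges
  `stub_cofactorSign_of_posV` (p95446), `stub_im_of_cofactorSign` (p95449) imported ⇒ `im_via_posV`.
* CORE C (cubic-monomial normal form, ≡ IM): `stub_law2` OPEN; bridge C2 `stub_imNonadj_of_law2` OPEN
  (finite; auxiliaries p100952 imported), C3 `stub_row_deg_le_two` (p99845), C4 `stub_imDeg3_of_nonadj`
  (p100050), C5 `stub_im_of_imDeg3` (p99785) imported ⇒ `im_via_law2` = `InverseMFerromagnet_of`.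
* CORE D (NEW, Bethe normal form; lead c2 + card `stieltjes-loop-correction`): with the BETHE PRECISION
  `Γ_B` (`(Γ_B)_xy = −½ sinh 2κ_xy`, `(Γ_B)_xx = 1 + Σ_y sinh² κ_xy`, `κ_xy` = total coupling on `{x,y}`;
  `Γ_B = Σ⁻¹` exactly on forests) the crux is EQUIVALENT to B♯ `Σ⁻¹ ≤ Γ_B` off the diagonal and to the
  dressed edge bound DB♯ `(Σ⁻¹)_xy ≤ −t/(1+t²−2t⟨σ_xσ_y⟩)` (`t = tanh κ_xy`) through the exact
  subdivision identity; the LOOP CORRECTION `S := Σ⁻¹ − Γ_B` is block-additive over 1-sums, equals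
  `2T/(1−T)·Γ_B` on every cycle (`T = ∏ tanh κ_e`, arbitrary couplings — `helper_cycle_precision` below),
  reduces over 2-sums (IM for all graphs ⇔ DB♯ for 3-connected graphs), and is numerically a STIELTJES
  matrix (PSD, Z-pattern, nonnegative diagonal) in ~3 000 exact / 60-digit instances (n ≤ 16, all
  temperatures; this lead: exp/bethe_gap*.py, 0/5 800 pairs; card: kit j013446/j013533/j013904) while
  its row sums are NOT always ≥ 0 (n = 7 witness, this lead).  Registered here: the conditional dividend
  `helper_db_of_im` (IM ⇒ DB♯: the crux self-improves to a quantitative margin on every edge) and the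
  cycle closed form `helper_cycle_precision`; the open Z-statement itself is IM (no new core stub needed:
  by C3+C4+C5 only NON-ADJACENT pairs of degree ≤ 3 matter, which is what `stub_imNonadj_of_law2` feeds).
* `InverseMFerromagnet_of := im_via_law2`.

PAPER TOOLS (lead c1, Cruxes/…/NOTES.md): T1 CCA, T2 NLD, T3 axial torus entries by RP; conjectures NLC,
ALB (0 violations).  Lead c2 additions: PCM dual = domination principle ("a field increment raising every
magnetisation raises the pressure"), PCM♯ `Cov_h⁻¹ m_h ≥ ½ sinh 2h` componentwise (= B♯ on the ghost edges),
Newton reading (the Newton step for `m(h) = 0` from `h ≥ 0` overshoots every coordinate), 1/N check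
(one-loop self-energy `(2/N)·G∘(G∘G)⁻¹` is Stieltjes by Schur product + Chen's Hadamard theorem).

DISPROOF USED (`Cruxes/InverseMFerromagnet/Disproof.lean` v6, read 2026-08-16T12:45Z, unchanged since
c1): `inverseM_false_without_nonneg` (K ≥ 0 enters S3/S5, level ≤ 1, C2's κ ≤ 0, and D's ⟨σσ⟩ ≥ tanh κ),
`inverseM_false_without_pair` (pair structure: S4/S6, C2/C3 degree-≤2 linearity, D's Γ_B and degree-2
rows), `not_precisionAntitone` (no coupling monotonicity anywhere; D adds: entries are not monotone along
uniform temperature rays either, card SLC dead line β), `inverseM_tight_at_twoSeparator` (C2/C3 and the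
2-sum formula are equalities across ≤2-separators); docblock (d) `TriplePartialCovLaw` IS C1; THETA law =
leading term of S off the edges (−4N_Θ t^ℓ).  No `-- Targets` section exists yet.
-/

namespace Summit.CriticalPhenomena.Ising3DConformalLimit.Cruxes.InverseMFerromagnet.PartialCovarianceLadder

open Literature.Probability.LatticeModels Finset Matrix
open Summit.CriticalPhenomena.Ising3DConformalLimit.Theses.PrecisionLaplacian (InverseMFerromagnet)
open scoped symmDiff

noncomputable section

/-! ## Core B (combinatorial): the Edwards–Sokal cofactor polynomials

`M_pq(X) = ∑_ω σ_pσ_q ∏_i (1 + ((1+ω_{C_i})/2) X_i)`; POS-v: every coefficient of every off-diagonal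
adjugate entry is `≤ 0` (⇔ Bernstein positivity in `t = tanh K`).  Bridges B1, B2 imported (p95446, p95449). -/

/- **B0 · POS-v (the combinatorial core; documented, de-registered in v6 to keep ≤ 7 stubs).**
For pair supports, every coefficient of every off-diagonal adjugate entry of the Edwards–Sokal
polynomial matrix `M_pq(X) = ∑_ω σ_pσ_q ∏_i (1 + ((1+ω_{C_i})/2)·X_i)` is nonpositive:

    theorem stub_posV :
        ∀ (n m : ℕ) (C : Fin m → Finset (Fin n)), (∀ i, (C i).card = 2) → ∀ x y : Fin n, x ≠ y →
          ∀ d : Fin m →₀ ℕ,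
            ((Matrix.of fun p q : Fin n => ∑ ω : SpinConfig (Fin n),
                MvPolynomial.C (spinAt p ω * spinAt q ω) *
                  ∏ i : Fin m, (1 + MvPolynomial.C ((1 + spinProduct (C i) ω) / 2) * MvPolynomial.X i)
              : Matrix (Fin n) (Fin n) (MvPolynomial (Fin m) ℝ)).adjugate x y).coeff d ≤ 0

and `im_via_posV : InverseMFerromagnet := stub_im_of_cofactorSign (stub_cofactorSign_of_posV stub_posV)`
through the landed bridges B1 (p95446) and B2 (p95449).  Status: strictly stronger than IM; 0 positive
coefficients for all graphs n ≤ 5, all 103 connected graphs n = 6 with m ≤ 11 (c1 worker, exact), and —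
its UNIVARIATE shadow (uniform coupling) — certified in-tree graph by graph by the ccert seat's
kernel-decidable checker (`IsingPolynomial.check/checkSym/checkAuto`, 44 named graphs n ≤ 20 and the
5×5 torus): the CERTIFICATE LANE of this crux.  A kernel certificate cannot settle the universally
quantified crux; it can only refute it (shape `exists_inv_entry_pos_of_imCertCheck`) or certify instances. -/


/-! ## Core C (lead c1): the cubic-monomial normal form `Law₂` and its bridge to IM

IM ⇔ Law₂ (Cruxes/…/NOTES.md, E1).  C3–C5 imported; C1 is the open core, C2 the open finite bridge. -/

/-- **C1 · Law₂ (triple partial-covariance law) — THE OPEN CORE in normal form.**  For every zero-field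
pair ferromagnet and all 3-sets of sites `A, B`, the partial covariance of the cubics `σ_A`, `σ_B` given
the linear span of the single spins is nonnegative:
`⟨σ_Aσ_B⟩ ≥ v_Aᵀ Σ⁻¹ v_B`, `v_A(w) = ⟨σ_Aσ_w⟩` (2-, 4- and 6-point functions only).  Equivalent to the
crux (probe attachment one way; subdivision + star–triangle + contraction the other). [folklore] -/
theorem stub_law2 :
    ∀ (n m : ℕ) (K : Fin m → ℝ) (C : Fin m → Finset (Fin n)), (∀ i, 0 ≤ K i) → (∀ i, (C i).card = 2) →
      ∀ (A B : Finset (Fin n)), A.card = 3 → B.card = 3 →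
        dotProduct (fun w => gksExpect Finset.univ K C (fun ω => spinProduct A ω * spinAt w ω))
          (((Matrix.of fun p q : Fin n =>
              gksExpect Finset.univ K C (fun ω => spinAt p ω * spinAt q ω))⁻¹).mulVec
            (fun w => gksExpect Finset.univ K C (fun ω => spinProduct B ω * spinAt w ω)))
        ≤ gksExpect Finset.univ K C (fun ω => spinProduct A ω * spinProduct B ω) := by
  sorry


/-- IM via core C (Law₂): C2 feeds the imported C4 (full subdivision), together with the imported C3
(degree-≤2 rows); the imported C5 (contraction limit) removes the degree bound. [folklore] -/
theorem im_via_law2 : InverseMFerromagnet :=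
  stub_im_of_imDeg3 (stub_imDeg3_of_nonadj (stub_imNonadj_of_law2 stub_law2) stub_row_deg_le_two)

/-! ## Cores C2 and D, T-SP, theta anchors — ALL LANDED (imported kernel facts of this namespace)

* C2 `stub_imNonadj_of_law2` (Law₂ ⇒ IM at non-adjacent pairs of degree ≤ 3): p116381 (c2; accepted 19:0xZ).
* Core D (lead c2): `helper_db_of_im` p110320, `helper_cycle_precision` p112285, `helper_oneSum_precision` p114838,
  `helper_twoSep_markov` p115890, `helper_twoSum_precision` p116268, `helper_db_deg2_eq` p117086,
  `helper_marginal_twoSep` p117607, `helper_db_glue_ineq` p116872, dividend `helper_im_le_five` p109007.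
* **T-SP (lead c3, wave 1 + assembly): `helper_im_seriesParallel` / `helper_db_seriesParallel` p122801 — DB♯, hence
  IM, for EVERY series–parallel (K₄-minor-free) zero-field pair ferromagnet, arbitrary couplings**; inductive class
  `IsSeriesParallel` (Defs p122073); steps `helper_sp_base` p118925, `helper_sp_pendant` p119508, `helper_sp_parallel`
  p118957, `helper_sp_subdivide` p121956 (+ p119976 p120527 p121283), `helper_sp_relabel` p118988.  First extension of
  Lauritzen–Uhler–Zwiernik 2021 Prop. 5.3 (cycles) to an infinite minor-closed class; K₄ is the first graph outside it.
* Theta-law anchors (lead c3, wave 2): `helper_K23_precision` p124081 (+ p123666) — `(Σ⁻¹)_hub,hub` of `K₂,₃` with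
  arbitrary couplings `= ½cosh²A (tanh A − Σ_i tanh(A − 2a_i)) = 2cosh²A·κ(a)`, `tanh a_i = tanh b_i tanh c_i`;
  `helper_subdivide_entry_invariant` p122805 — subdividing a bond changes no precision entry away from it.  Together:
  the closed form on every theta graph `θ(ℓ₁,ℓ₂,ℓ₃)`, `ℓ_i ≥ 2`, with leading term `−4τ₁τ₂τ₃`; with the exact zeros
  across ≤2-separators this is the THETA LAW `Γ_xy = −4Σ_θ t^θ + O(t^{L_θ+1})` (crux NOTES G1; the multivariate
  power-series support lemma is the only unformalised step).

What remains open in this skeleton is exactly ONE leaf: `stub_law2` (≡ IM). -/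

/-! ## Lead c5: the first rung of the open core is a kernel theorem
* `helper_law2_four` (p129163): `stub_law2` restricted to `n = 4`, all multigraph supports, all couplings — via the
  odd-monomial Gram DUALITY `𝔾^K·𝔾^{−K} = 4ⁿ/(Z_KZ_{−K})·Id` (`helper_odd_gram_duality`, p128610, general `n`), the block
  identity `Σ − ŨΣ⁻¹Ũ = c·(Σ^{AF})⁻¹`, and the level-2 fact that the 4-site ANTIferromagnet has precision entries `≥ 0`
  off the diagonal (`helper_af_precision_nonneg_four`, p129018).  Certificate found first: the bordered-Gram polynomial
  `P_AB = M_AB·det M − m_Aᵀadj(M)m_B` has 3954 monomials in `X = e^{2K} − 1`, all positive; it factors as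
  `2¹⁵(Y₀₁²−1)·(positive)`.
* `helper_nim3_six_of` (p129538): NIM₃ on six sites (IM at every non-adjacent pair of bond-degree ≤ 3 of every 6-site
  ferromagnet) from the local Law₂ `helper_law2_six_free` (transport of `helper_law2_four`; in flight).
* Normal forms found (crux NOTES / FINDINGS-c5): parallel-sum form of the `|A∩B| = 2` family
  (`G = 4[p₊⁻¹C_g⁻¹ + p₋⁻¹C_h⁻¹]⁻¹`, soft proof for `n ≤ 5`), the cone statements MC2 / FDC / Z-FLOW (each ⇔ or ⇒ IM),
  AmpU4 (once-amputated Lebowitz, `0 ≤ H ≤` tree bound, support = 3-fans) and **GHS-m** (`m ≥ 0 ⇒ u₃ ≤ 0` under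
  arbitrary-sign fields; ⇒ AmpU4 ⇒ IM; 0 violations in ~5·10⁴ triples incl. adversarial search). -/

/-! ## Wave 3 (lead c3) — LANDED: `helper_precision_zero_of_oneSep` / `helper_precision_zero_of_twoSep` p124285 (exact zeros of
`Σ⁻¹` across ≤2-separators as clean statements — the exact-zero half of the theta law) and `helper_twin_nonpos` p124513
(IM at non-adjacent degree-3 TWINS `∂x = ∂y` in any graph, e.g. all same-side pairs of `K₃,₃`, `K₃,m`: the two cubics
coincide, PCov = κ_xκ_y‖σ_{∂x} − Pσ_{∂x}‖² ≥ 0). -/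


/-! ## Wave 4 (lead c3): the size-local self-improvement and DB♯ on ≤ 4 sites

`helper_db_of_im` is stated under the GLOBAL crux; its proof uses IM only one size up (one subdivision site).
The local form turns the landed `helper_im_le_five` into DB♯ on ≤ 4 sites, so that the T-SP constructor steps
(`helper_sp_pendant/parallel/subdivide/relabel`, which never use series–parallelness) propagate DB♯, hence IM, to
every structure REDUCIBLE TO ≤ 4 SITES by deleting pendant sites, suppressing degree-2 sites and merging parallel
bonds — e.g. every subdivision of `K₄` with pendant trees attached (treewidth 3), beyond T-SP.
LANDED: `helper_db_of_im_local` + `helper_db_le_four` p124820. -/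





/-! ## Lead c6: THEOREM W — IM for ALL WHEELS `W_n` with arbitrary positive couplings (LANDED, imported)
`helper_im_wheel` (module `…Wheel`): for every `n ≥ 3`, rim couplings `K > 0`, spoke couplings `h > 0`, every off-diagonal entry
of the inverse spin second-moment matrix of the zero-field Ising model on the wheel is `≤ 0` — the first infinite family of
3-connected graphs with arbitrary couplings (T-SP stops at treewidth 2, `helper_im_le_five` at five sites).  Ingredients
(all kernel facts): `stub_wheel_ringsum` (apex reduction, p143414), `stub_wheel_sl2` (the four-dimensional identity
`𝒜⁻¹ = x₀I + x₋S₋ + x_cS + x₊S₊` in `M₂(ℝ)`, p143471), `stub_wheel_column` (trace bookkeeping, p143520), `helper_wheel_core`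
(linear-algebra core: one column relation per rim site ⇒ hub entries share a sign ⇒ all entries `≤ 0`, p143334), and the assembly
with the rotation of the ring (`wglue_ringsum_rotate`, `wglue_column_at`).  Paper: crux NOTES K6 / WHEELS.md. -/

/-! ## Lead c6, wave 2 (LANDED, imported): `helper_im_wheel_nonneg` — Theorem W for NONNEGATIVE couplings (module …WheelNonneg),
by continuity from `helper_im_wheel`; in particular IM for every once-rim-subdivided wheel (DB♯ on every rim bond of every wheel). -/

/-- **Only non-adjacent pairs of degree ≤ 3 matter** (kernel composition of the imported C4, C3, C5):
NIM₃ ⇒ IM. [folklore] -/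
theorem helper_im_of_nim3 :
    (∀ (n m : ℕ) (K : Fin m → ℝ) (C : Fin m → Finset (Fin n)), (∀ i, 0 ≤ K i) → (∀ i, (C i).card = 2) →
      ∀ x y : Fin n, x ≠ y → (∀ i, ¬ (x ∈ C i ∧ y ∈ C i)) →
        (Finset.univ.filter (fun i => x ∈ C i)).card ≤ 3 → (Finset.univ.filter (fun i => y ∈ C i)).card ≤ 3 →
        (Matrix.of fun p q : Fin n => gksExpect Finset.univ K C (fun ω => spinAt p ω * spinAt q ω))⁻¹ x y ≤ 0) →
    InverseMFerromagnet :=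
  fun h => stub_im_of_imDeg3 (stub_imDeg3_of_nonadj h stub_row_deg_le_two)

/-! ## The dividend of the ladder: IM on at most five sites (now sorry-free) -/

-- `helper_im_le_five` (IM on ≤ 5 sites) is the landed module `…ImLeFive` (p109007), imported above.

/-! ## Lead c7: CORE E — the DELETION–CONTRACTION PENCIL (skeleton v15)

New this cycle (crux NOTES c7): for a bond pair `{u,v}` with total coupling `K_e`, the spin second-moment
matrix of `G` moves on the straight SEGMENT between those of `G−e` (all bonds on `{u,v}` switched off) and
the lifted contraction `G/e` (FK deletion–contraction for the measure: `μ_G = (1−w)μ_{G−e} + w·μ_{G−e}(·|σ_u=σ_v)`,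
`w = P_FK(e open)`), and for every pair `p,q ∉ {u,v}` the precision entry `t_e ↦ (Σ_G⁻¹)_pq` was found
(exact rationals, ~2500 instances `n ≤ 9`, adversarial climbs, 0 violations) to have NO interior local maximum
on the ferromagnetic side; in particular its sign is controlled by the two endpoint values
`(Σ_{G−e}⁻¹)_pq` (fewer nonzero bonds) and `(Σ_{G/e}⁻¹)_pq` (fewer nonzero bonds).  Hence the induction
E3: SP (E1) + the hub-pair base case (E2: every nonzero bond meets `{p,q}`, a series–parallel structure) ⇒ IM,
by induction on the number of nonzero couplings with `n`, `m` FIXED (deletion = couplings on `{u,v}` set to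
`0`; contraction = bonds at `v` moved to `u`, the bonds on `{u,v}` re-supported on the dummy pair `{p,q}`
with coupling `0`, `v` left isolated).  E1 is the open core (≡ IM: IM ⇒ E1 trivially); E2, E3 are finite. -/

/-- **E1 · SP — sign preservation along one coupling (THE OPEN CORE of core E).**  For a zero-field pair
ferromagnet, a pair of sites `u ≠ v` and a pair `p ≠ q` disjoint from `{u,v}`: if the `(p,q)` precision entry is
`≤ 0` both after switching off every bond supported on `{u,v}` (deletion) and in the contracted system (the same
switched-off couplings, the bonds at `v` moved to `u`, the switched-off bonds re-supported on `{p,q}`; `v` isolated),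
then it is `≤ 0` at the actual couplings.  Numerically the entry is even quasi-convex in `tanh K_e` between the two
endpoint values (crux NOTES c7); equivalent to the crux (IM gives the conclusion outright). [folklore] -/
theorem stub_sp :
    ∀ (n m : ℕ) (K : Fin m → ℝ) (C : Fin m → Finset (Fin n)), (∀ i, 0 ≤ K i) → (∀ i, (C i).card = 2) →
      ∀ (u v p q : Fin n), u ≠ v → p ≠ q → p ≠ u → p ≠ v → q ≠ u → q ≠ v →
        (Matrix.of fun a b : Fin n =>
            gksExpect Finset.univ (fun i => if C i = {u, v} then 0 else K i) C
              (fun ω => spinAt a ω * spinAt b ω))⁻¹ p q ≤ 0 →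
        (Matrix.of fun a b : Fin n =>
            gksExpect Finset.univ (fun i => if C i = {u, v} then 0 else K i)
              (fun i => if C i = {u, v} then ({p, q} : Finset (Fin n))
                else (C i).image (fun z => if z = v then u else z))
              (fun ω => spinAt a ω * spinAt b ω))⁻¹ p q ≤ 0 →
        (Matrix.of fun a b : Fin n => gksExpect Finset.univ K C (fun ω => spinAt a ω * spinAt b ω))⁻¹ p q ≤ 0 := by
  sorry

-- E2 `stub_im_hubpair` (hub pairs are series–parallel ⇒ T-SP) LANDED: module …Theorems.PrecisionLaplacianInverseMFerromagnetHubPair (p148342), imported.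

-- E3 `stub_im_of_sp` (the deletion–contraction induction) LANDED: module …Theorems.PrecisionLaplacianInverseMFerromagnetImOfSp (p148185), imported.

-- E4 `helper_pencil_mixture` LANDED: module …Theorems.PrecisionLaplacianInverseMFerromagnetPencilMixture (p149870), imported.

-- E5 `helper_contraction_conditioning` (contraction = conditioning on agreement) LANDED: module …Theorems.PrecisionLaplacianInverseMFerromagnetContractionConditioning (p150340), imported.

/-- IM via core E (the deletion–contraction pencil): E3 fed with E1 and E2. [folklore] -/
theorem im_via_sp : InverseMFerromagnet :=
  stub_im_of_sp stub_sp stub_im_hubpair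

/-! ## Core F (lead c7, v18): ROW TRANSFER — one bond, one row, one sign

For a bond with support `{p,v}` let `H` be the system with that support zeroed and `W = V∖{p,v}`.  The conditional
mean `E[σ_x | σ_p,σ_v] = c_p(x)σ_p + c_v(x)σ_v` is exactly linear and the same for `G` and `H`, so the block-inverse
identity `Γ[U,W] = −Ξ·Γ[W,W]` (`Ξ = Σ[U,U]⁻¹Σ[U,W]`, the same for both) gives
`−Γ_G[p,W] = (−Γ_H[p,W]) · T`, `T = (Γ_H[W,W])⁻¹Γ_G[W,W] = (1+ρt)(I − t·((Γ_{G'}F)[W,W])ᵀ)` with `Σ_{G'} = Σ_H + tF`,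
`F = E_H[σσᵀσ_pσ_v]`, `t = tanh κ_{pv}`, `ρ = ⟨σ_pσ_v⟩_H`; and `Γ_G F_G = tI + (1−t²)Γ_{G'}F`.  Hence the amputated
four-point sign F1 gives `T ≥ 0`, i.e. the ROW TRANSFER F2, and IM follows by induction on the nonzero bonds (F3):
to sign `Γ[x,y]` delete a bond at `x` that does not point to `y` (pendant case direct).  No contraction endpoint,
no own-edge entry, no calculus (crux NOTES c7 part 9; all identities exact-checked).  F1 is c5's AmpU4 off the pair
(≡ IM by the c5 census); F2, F3 are the new bridge. -/

/-- **F1 · `stub_amp` — THE OPEN CORE in amputated form (≡ IM).**  For every zero-field pair ferromagnet, every pair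
`p ≠ v` and all `x, y ∉ {p,v}`: `Σ_z (Σ⁻¹)_{xz} ⟨σ_zσ_yσ_pσ_v⟩ ≤ δ_{xy}` — the `W×W` block of `Θ = Σ⁻¹F^{pv}` has
nonpositive off-diagonal entries and diagonal at most `1` (numerically even `≤ ⟨σ_pσ_v⟩`).  Off the diagonal this is
`Σ_z (Σ⁻¹)_{xz} u₄(z,y,p,v) ≤ 0` (one-leg-amputated Lebowitz), equivalently `Cov(η_xσ_y, σ_pσ_v) ≤ 0` for the dual spins
`η = Σ⁻¹σ`, equivalently `Cov(η_x, σ_y | σ_p = +, σ_v = −) ≥ 0`.  0 violations (exact, n ≤ 8; floats + climbs n ≤ 10). [folklore] -/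
theorem stub_amp :
    ∀ (n m : ℕ) (K : Fin m → ℝ) (C : Fin m → Finset (Fin n)), (∀ i, 0 ≤ K i) → (∀ i, (C i).card = 2) →
      ∀ (p v x y : Fin n), p ≠ v → x ≠ p → x ≠ v → y ≠ p → y ≠ v →
        ((Matrix.of fun a b : Fin n => gksExpect Finset.univ K C (fun ω => spinAt a ω * spinAt b ω))⁻¹ *
            (Matrix.of fun a b : Fin n =>
              gksExpect Finset.univ K C (fun ω => spinAt a ω * spinAt b ω * (spinAt p ω * spinAt v ω)))) x y ≤
          if x = y then 1 else 0 := by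
  sorry

-- F2 `stub_rowTransfer_of_amp` (AMP ⇒ ROW TRANSFER) LANDED: module …Theorems.PrecisionLaplacianInverseMFerromagnetRowTransferOfAmp (p153932), imported.

-- F3 `stub_im_of_rowTransfer` (ROW TRANSFER ⇒ IM, induction on nonzero bonds) LANDED: module …Theorems.PrecisionLaplacianInverseMFerromagnetImOfRowTransfer (p153930), imported.

/-- IM via core F (row transfer): F3 fed with F2 fed with F1. [folklore] -/
theorem im_via_amp : InverseMFerromagnet :=
  stub_im_of_rowTransfer (stub_rowTransfer_of_amp stub_amp)

/-! ## Lead c8 (v20): LEVEL 4 anatomy — `Law₂` on FOUR VISIBLE spins with hidden spins (dividend rung)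

For `x ≠ y` and a 4-set `S ∌ x, y` (any number of further, hidden sites):
`PCov(x,y | lin σ_S) = E[Cov(σ_x,σ_y | σ_S)] + κ^{xᵀ} G_S κ^y`, `G_S` = the `Law₂`-Gram of the four cubics of `S`
under the `S`-marginal, `κ^x` = cubic Walsh vector of `E[σ_x | σ_S]` (crux FINDINGS-c8, L2).  The Gram factor is
settled by the three stubs below (L1): the `S`-marginal `ν` of a pair ferromagnet is even, positive and satisfies the
FKG lattice condition (G2, four-functions theorem), and every such measure on `{±1}⁴` satisfies `Law₂` (G1: odd-Gram
duality `ogd_core` with the dual weight `1/ν`, whose conditional pair couplings `−J'_{ij} ∓ L ≤ 0` are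
antiferromagnetic BECAUSE `J'_{ij} ≥ |L|` is exactly the lattice condition of `ν`; then the antiferromagnetic
level-2 sign as in `helper_af_precision_nonneg_four`).  G3 glues them to the `n`-site correlations.  This extends
`helper_law2_four` (pair ferromagnets ON four sites) to four VISIBLE sites of any pair ferromagnet — c1's
conjecture C3 "OddLaw-visible" at `|T| = 4`.  What level 4 still needs beyond it is the cone law
`κ^{xᵀ}G_Sκ^y ≥ 0` for REALIZABLE cubic vectors (numerically `G_Sκ^x ≤ 0` entrywise, 0/48 936; the relaxation to
all odd increasing conditional-magnetisation profiles is false, FINDINGS-c8 L2). -/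

-- G1 `helper_law2_four_mtp2` (Law₂ on {±1}⁴ for every positive even FKG-lattice weight) LANDED: module …Theorems.PrecisionLaplacianInverseMFerromagnetLaw2FourMtp2 (p159751, c8 wave 1), imported.

-- G2 `helper_marginal_four_mtp2` (marginal on four visible sites is positive, even, FKG-lattice) LANDED: module …Theorems.PrecisionLaplacianInverseMFerromagnetMarginalFourMtp2 (p159067, c8 wave 1), imported.

-- G3 `helper_law2_fourVisible_of` (glue G1 + G2 ⇒ Law₂ on four visible sites) LANDED: module …Theorems.PrecisionLaplacianInverseMFerromagnetLaw2FourVisible (p159059, c8 wave 1), imported.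

-- ASSEMBLY `helper_law2_fourVisible` (Law₂ on four visible sites with hidden spins = G3 fed with G1, G2) LANDED: module
-- …Theorems.PrecisionLaplacianInverseMFerromagnetLaw2FourVisibleAssembly (p160125, c8), imported.

/-! ## Lead c8 (v22): the LEVEL-4 RUNG stated (conjectural stubs, ≡ sub-cases of IM; numerically 0/≈5·10⁴, FINDINGS-c8 L2)

With the Gram half landed, level 4 (= IM on every 6×6 principal submatrix, hence IM(6)) is exactly the cone law for
realizable cubic vectors.  Two precise Lean targets for the next seats / the disprover / the certificate lane: -/

/-- **R1 · `stub_cpl4` — the visible cubic-predictor law at four conditioning spins (CPL₄, conjectural; ≡ a sub-case of IM).**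
For `K ≥ 0`, `|C i| = 2`, a site embedding `e : Fin 4 ↪ Fin n`, a site `x` off its image and a 3-set `T ⊆ Fin 4`:
`PCov(σ_x, σ_{e(T)} | lin σ_{e(Fin 4)}) ≤ 0`, i.e. `⟨σ_xσ_{e(T)}⟩ ≤ v_xᵀ (Σ|_{e(Fin 4)})⁻¹ v_{e(T)}` with `v_x(w) = ⟨σ_xσ_{e w}⟩`,
`v_{e(T)}(w) = ⟨σ_{e(T)}σ_{e w}⟩`.  Equivalently `(G_S κ^x)_T ≤ 0` in the level-4 anatomy.  0 violations in ≈ 5·10⁴ exact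
instances (n ≤ 8); at `n = 6` with `deg y = 3` it is IM(6) itself; open. [folklore] -/
theorem stub_cpl4 :
    ∀ (n m : ℕ) (K : Fin m → ℝ) (C : Fin m → Finset (Fin n)), (∀ i, 0 ≤ K i) → (∀ i, (C i).card = 2) →
      ∀ (e : Fin 4 ↪ Fin n) (x : Fin n), (∀ k, e k ≠ x) → ∀ (T : Finset (Fin 4)), T.card = 3 →
        gksExpect Finset.univ K C (fun ω => spinAt x ω * spinProduct (T.map e) ω) ≤
          dotProduct (fun w => gksExpect Finset.univ K C (fun ω => spinAt x ω * spinAt (e w) ω))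
            (((Matrix.of fun p q : Fin 4 =>
                gksExpect Finset.univ K C (fun ω => spinAt (e p) ω * spinAt (e q) ω))⁻¹).mulVec
              (fun w => gksExpect Finset.univ K C (fun ω => spinProduct (T.map e) ω * spinAt (e w) ω))) := by
  sorry

/-- **R2 · `stub_level4` — LEVEL 4 (conjectural; ≡ IM on every 6×6 principal submatrix, a consequence of IM).**
For `K ≥ 0`, `|C i| = 2`, `e : Fin 4 ↪ Fin n` and two distinct sites `x, y` off its image:
`PCov(σ_x, σ_y | lin σ_{e(Fin 4)}) ≥ 0`, i.e. `v_xᵀ(Σ|_{e(Fin 4)})⁻¹v_y ≤ ⟨σ_xσ_y⟩`.  With `n = 6` this is IM(6) (all 15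
couplings; ⇔ PCM(5)); in the anatomy it is `E[Cov(σ_x,σ_y|σ_S)] + κ^{xᵀ}G_Sκ^y ≥ 0` with both `ECov ≥ 0` and `G_S ≥ 0`
known and `κ` of mixed signs. 0 violations in every search of the crux record; open. [folklore] -/
theorem stub_level4 :
    ∀ (n m : ℕ) (K : Fin m → ℝ) (C : Fin m → Finset (Fin n)), (∀ i, 0 ≤ K i) → (∀ i, (C i).card = 2) →
      ∀ (e : Fin 4 ↪ Fin n) (x y : Fin n), x ≠ y → (∀ k, e k ≠ x) → (∀ k, e k ≠ y) →
        dotProduct (fun w => gksExpect Finset.univ K C (fun ω => spinAt x ω * spinAt (e w) ω))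
            (((Matrix.of fun p q : Fin 4 =>
                gksExpect Finset.univ K C (fun ω => spinAt (e p) ω * spinAt (e q) ω))⁻¹).mulVec
              (fun w => gksExpect Finset.univ K C (fun ω => spinAt y ω * spinAt (e w) ω)))
          ≤ gksExpect Finset.univ K C (fun ω => spinAt x ω * spinAt y ω) := by
  sorry

/-! ## Lead c8 (v23): the realizable cubic cone — pairwise law K2 (delegable; = F4 of crux 4801 on a contraction)

Numerically (kpair.py, hidden spins, 2 177 instances, 0 violations) the cubic Walsh vector `κ` of `E[σ_g | σ_S]`,
`|S| = 4`, satisfies `κ_{S∖i} + κ_{S∖j} ≤ 0` for all `i ≠ j` although single entries are positive in 12 % of cases; so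
realizable `κ` lie in the cone `{κ : κ_a + κ_b ≤ 0} = cone{−e_a, e_a − Σ_{b≠a} e_b}`.  In restricted-sum form this is a
SECOND difference of the conditional magnetisation in two boundary spins with TWO positively clamped spins — the member
"F4 with one more clamp" of the VP¹ family, and exactly F4 (`stub_condCubicNonpos`, p150670, crux 4801) applied to the
system in which `j` is contracted onto `i`. -/

-- K2 `helper_twoClamp_secondDiff_nonpos` (second difference with two positive clamps ≤ 0; pairwise cubic law) LANDED: module
-- …Theorems.PrecisionLaplacianInverseMFerromagnetTwoClampSecondDiff (p170265, c8 wave 2; route: pin j to +1 = erase j from supports, then `stub_condCubicNonpos`), imported.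

/-! ## Lead c8 (v24): LOW TEMPERATURE IS ULTRAMETRIC — the strictly-ultrametric-matrix theorem (delegable, Literature-grade)

At low temperature `Σ = J − 2d`, `d_xy = P(σ_x ≠ σ_y) ≈ e^{−2βλ_xy}` with `λ` the minimum-cut function, a cut-ULTRAMETRIC
(Gomory–Hu), so the leading-order correlation matrix `J − 2e^{−2βλ}` is STRICTLY ULTRAMETRIC; strictly ultrametric matrices
are inverse M-matrices with row diagonally dominant inverses (Martínez–Michon–San Martín 1994; Nabben–Varga 1994; DMS 2014
ch. 3).  The tree has `IsInverseMMatrix` (Literature/LinearAlgebra/Matrix/InverseMMatrix.lean) but not the ultrametric theorem;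
the stub below is its statement in elementary form (to be landed as a Literature theorem and re-exported here).  The
tropical refinement (FINDINGS-c8 L11–L13): on `K_n` with generic weights the trailing term of `adj(Σ)_xy` is
`−4^{n−2} e^{−2βΦ_xy}`, `Φ_xy` = weight of the Gomory–Hu cut basis of the CONTRACTED graph `G/xy` (n ≤ 6: 100 %). -/

-- U1 `helper_strictlyUltrametric_inverse` (strictly ultrametric ⇒ nonsingular, inverse Z, inverse row sums ≥ 0; DMS Thm 3.5 via
-- Prop 3.4 block split + Nabben–Varga rank-one update) LANDED: module …Theorems.PrecisionLaplacianInverseMFerromagnetStrictlyUltrametric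
-- (p170719, c8 wave 3; reusable `su_isPotentialMatrix` for any Fintype index), imported.

/-! ## The composition: the stubs prove the crux BY NAME -/

/-- **`InverseMFerromagnet_of`** — the crux from the stubs, through core F (lead c7, v18): the amputated four-point
sign (F1) gives the row transfer (F2), which gives IM by induction on the nonzero bonds (F3).
(`im_via_sp` is the alternative composition through core E, `im_via_law2` through core C, `im_via_posV` through core B.) -/
theorem InverseMFerromagnet_of : InverseMFerromagnet :=
  im_via_amp

end

end Summit.CriticalPhenomena.Ising3DConformalLimit.Cruxes.InverseMFerromagnet.PartialCovarianceLadder
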